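import Summits.BirchSwinnertonDyer.BirchSwinnertonDyer.Theses.UniversalToricDescent
import Summits.BirchSwinnertonDyer.BirchSwinnertonDyer.Theorems.UniversalToricDescentTwinSplitIMCAtThreeOfThreeFrames
import HarnessLib

/-!
# Route `UniversalToricDescent`, crux `TwinSplitIMCAtThreeGoodSSApZero` (stmt-BirchSwinnertonDyer-23594, bucket
# C₀ = good-supersingular `a₃ = 0` twins): the crux is, BY NAME and UNCONDITIONALLY, the conjunction of
# its two one-sided halves — ONE Howard-direction frame
# (`L ∈ Ch_Λ(X_{∅,0})·R₀⟦T⟧`, the Kolyvagin direction `⊇`) and ONE integral Wan-direction frame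
# (`Ch_Λ(X_{∅,0})·R₀⟦T⟧ ⊆ (L)`, the Eisenstein direction `⊆`) at every datum — a LOSSLESS-SPLIT certificate

Seat `bsd-wall-utd-p2` g10 (LEAD prover, line `threeframes-apzero` on 23594; `--supports
stmt-BirchSwinnertonDyer-23594`). The registered skeleton stubs of the line are `∃`-frame statements
(`stub_howardFrameSS_apZero`, `stub_wanFrameSS_apZero`); the landed lattice theorems
`twinSplit_instance_of_two_frames` / `…_of_three_frames` / `…_of_howardFrame_of_wanFrame_of_good`
(p543791) give crux ⟸ halves. THIS FILE adds the trivial converse crux ⟹ halves (clause (i) supplies a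
frame, clause (ii) at that frame is an identity of ideals, so the frame lies on both sides) and packages the
EQUIVALENCES, so that a planner may file the two halves as separate items (the `⊇` half = an XL PORT of
Castella–Wan 2024 Thm. 5.12 + §6.1 to `p = 3`, `a_p = 0`; the `⊆` half = NOT IN PRINT at `p = 3` under the
classical Heegner hypothesis: every printed `N⁻ = 1` mechanism at a supersingular prime — CHKLL 2025 §7,
BLV 2026, BBL-II — is a bipartite Euler system over admissible primes, void at `p = 3` by the catalogued
barrier `Literature.Barriers.BirchSwinnertonDyer.NoAdmissiblePrimesAtThree`, and CW24 Thm. 5.3 / CLW22 need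
a non-split prime of `N′`) with the crux recovered by `exact` from the two.

* §1 (any prime `p`, abstract ideal `I ⊆ R₀⟦T⟧`, frames of one `(ι, 𝔭, κ, γ, f)`): `(i) ∧ (ii)` at a datum
  ⟹ a Howard frame (`L ∈ I`), an integral Wan frame (`I ≤ (L)`), a rational Wan frame (`∃ k, p^k·I ⊆ (L)`,
  with `k = 0`) — pure logic.
* §2 (`p = 3`, crux C₀'s literal currency): `howardHalf_of_twinSplitIMCAtThreeGoodSSApZero`,
  `integralWanHalf_of_…`, `wanHalf_of_…` (= the registered stub signatures), the converse
  `twinSplitIMCAtThreeGoodSSApZero_of_howardHalf_of_integralWanHalf` (via `twinSplit_instance_of_two_frames`,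
  NO named fact), the registered-stub converse `…_of_howardHalf_of_wanHalf_of_prop422` (via
  `twinSplit_instance_of_howardFrame_of_wanFrame_of_good`, CONDITIONAL on the refereed BCS 2025 Prop. 4.2.2),
  and the equivalence `twinSplitIMCAtThreeGoodSSApZero_iff_halves`. The same for `TwinSplitIMCAtThreeMult` (bucket B,
  item 20694) is the companion file `UniversalToricDescentTwinSplitIMCAtThreeMultHalves.lean`.

HONEST FRAMING: bookkeeping theorems (every crux and half is a displayed hypothesis or conclusion); nothing
here closes an item or proves an instance of either half; BSD is not proved for any curve by this file. No
definition, no new named fact, no `sorry`. Beyond-print theorem: NO.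

References: [Castella2018] Thm. 3.1 (the frame predicate `IsBDPLFunction`); [BurungaleCastellaSkinner2025]
Prop. 4.2.2; [CastellaWan2024] Thm. 5.12, §6.1, Thm. 5.3; [CastellaHsuKunduLeeLiu2025] = Trans. AMS Ser. B 12
(2025) 748–788 §7 (Thm. 7.1 displayed for `p > 2`, proof over admissible primes `q ≢ ±1 (mod p)`, Rem. 7.3);
[BertoliniLongoVenerucci2026] §3.2 (`p ≥ 5`); tree barrier `NoAdmissiblePrimesAtThree`.
-/

noncomputable section

open scoped Classical

set_option linter.dupNamespace false
set_option autoImplicit false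

namespace Summit.BirchSwinnertonDyer.BirchSwinnertonDyer.Theorems.UniversalToricDescentTwinSplit

open PowerSeries WeierstrassCurve NumberField IsDedekindDomain Field
  Literature.NumberTheory.EllipticCurves
  Literature.NumberTheory.EllipticCurves.ModularForms
  Literature.NumberTheory.EllipticCurves.Rank1Residual
  Summit.BirchSwinnertonDyer.Rank1Residual.X11b
  Summit.BirchSwinnertonDyer.Rank1Residual.X11b.Halves
  Summit.BirchSwinnertonDyer.BirchSwinnertonDyer.Theorems.SchneiderFree
  Summit.BirchSwinnertonDyer.BirchSwinnertonDyer.Theses.UniversalToricDescent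

/-! ## §1 Any prime, abstract ideal: `(i) ∧ (ii)` at a datum gives every one-sided frame there -/

section AnyPrime

variable {p : ℕ} [hp : Fact p.Prime] {K : Type} [Field K] [NumberField K] {N : ℕ}
  {ι : PadicAlgCl p ≃+* ℂ} {𝔭 : HeightOneSpectrum (𝓞 K)} {κ : ZpExtension K p}
  {γ : Field.absoluteGaloisGroup K} {f : CuspForm (CongruenceSubgroup.Gamma0 N) 2}
  {I : Ideal (UnrSeries p)}

/-- `(i)` a frame exists and `(ii)` `I = (L′)` at every frame ⟹ a HOWARD-direction frame: some frame
`L` with `L ∈ I`. [folklore] -/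
theorem exists_frame_mem_of_exists_of_forall_eq_span
    (hex : ∃ (ΩK : ℂ) (Ωp : ℂ_[p]) (L : UnrSeries p), ΩK ≠ 0 ∧ Ωp ≠ 0 ∧
      IsBDPLFunction ι 𝔭 κ γ f ΩK Ωp L)
    (hall : ∀ (ΩK : ℂ) (Ωp : ℂ_[p]) (L : UnrSeries p), ΩK ≠ 0 → Ωp ≠ 0 →
      IsBDPLFunction ι 𝔭 κ γ f ΩK Ωp L → I = Ideal.span {L}) :
    ∃ (ΩK : ℂ) (Ωp : ℂ_[p]) (L : UnrSeries p), ΩK ≠ 0 ∧ Ωp ≠ 0 ∧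
      IsBDPLFunction ι 𝔭 κ γ f ΩK Ωp L ∧ L ∈ I := by
  obtain ⟨ΩK, Ωp, L, hΩK, hΩp, hL⟩ := hex
  refine ⟨ΩK, Ωp, L, hΩK, hΩp, hL, ?_⟩
  rw [hall ΩK Ωp L hΩK hΩp hL]
  exact Ideal.mem_span_singleton_self L

/-- `(i)` a frame exists and `(ii)` `I = (L′)` at every frame ⟹ an INTEGRAL WAN-direction frame: some
frame `L` with `I ≤ (L)`. [folklore] -/
theorem exists_frame_le_span_of_exists_of_forall_eq_span
    (hex : ∃ (ΩK : ℂ) (Ωp : ℂ_[p]) (L : UnrSeries p), ΩK ≠ 0 ∧ Ωp ≠ 0 ∧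
      IsBDPLFunction ι 𝔭 κ γ f ΩK Ωp L)
    (hall : ∀ (ΩK : ℂ) (Ωp : ℂ_[p]) (L : UnrSeries p), ΩK ≠ 0 → Ωp ≠ 0 →
      IsBDPLFunction ι 𝔭 κ γ f ΩK Ωp L → I = Ideal.span {L}) :
    ∃ (ΩK : ℂ) (Ωp : ℂ_[p]) (L : UnrSeries p), ΩK ≠ 0 ∧ Ωp ≠ 0 ∧
      IsBDPLFunction ι 𝔭 κ γ f ΩK Ωp L ∧ I ≤ Ideal.span {L} := by
  obtain ⟨ΩK, Ωp, L, hΩK, hΩp, hL⟩ := hex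
  exact ⟨ΩK, Ωp, L, hΩK, hΩp, hL, (hall ΩK Ωp L hΩK hΩp hL).le⟩

/-- `(i)` a frame exists and `(ii)` `I = (L′)` at every frame ⟹ a RATIONAL WAN-direction frame in the
registered-stub currency: some frame `L` and some `k` (here `k = 0`) with `p^k · I ⊆ (L)`. [folklore] -/
theorem exists_frame_pow_mul_mem_span_of_exists_of_forall_eq_span
    (hex : ∃ (ΩK : ℂ) (Ωp : ℂ_[p]) (L : UnrSeries p), ΩK ≠ 0 ∧ Ωp ≠ 0 ∧
      IsBDPLFunction ι 𝔭 κ γ f ΩK Ωp L)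
    (hall : ∀ (ΩK : ℂ) (Ωp : ℂ_[p]) (L : UnrSeries p), ΩK ≠ 0 → Ωp ≠ 0 →
      IsBDPLFunction ι 𝔭 κ γ f ΩK Ωp L → I = Ideal.span {L}) :
    ∃ (ΩK : ℂ) (Ωp : ℂ_[p]) (L : UnrSeries p), ΩK ≠ 0 ∧ Ωp ≠ 0 ∧
      IsBDPLFunction ι 𝔭 κ γ f ΩK Ωp L ∧
      ∃ k : ℕ, ∀ G ∈ I, PowerSeries.C (((p : ℕ) : unrIntegers p) ^ k) * G ∈ Ideal.span {L} := by
  obtain ⟨ΩK, Ωp, L, hΩK, hΩp, hL, hle⟩ := exists_frame_le_span_of_exists_of_forall_eq_span hex hall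
  refine ⟨ΩK, Ωp, L, hΩK, hΩp, hL, 0, fun G hG ↦ ?_⟩
  rw [pow_zero, map_one, one_mul]
  exact hle hG

/-- An integral Wan frame is a rational Wan frame (`k = 0`). [folklore] -/
theorem exists_frame_pow_mul_mem_span_of_exists_frame_le_span
    (h : ∃ (ΩK : ℂ) (Ωp : ℂ_[p]) (L : UnrSeries p), ΩK ≠ 0 ∧ Ωp ≠ 0 ∧
      IsBDPLFunction ι 𝔭 κ γ f ΩK Ωp L ∧ I ≤ Ideal.span {L}) :
    ∃ (ΩK : ℂ) (Ωp : ℂ_[p]) (L : UnrSeries p), ΩK ≠ 0 ∧ Ωp ≠ 0 ∧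
      IsBDPLFunction ι 𝔭 κ γ f ΩK Ωp L ∧
      ∃ k : ℕ, ∀ G ∈ I, PowerSeries.C (((p : ℕ) : unrIntegers p) ^ k) * G ∈ Ideal.span {L} := by
  obtain ⟨ΩK, Ωp, L, hΩK, hΩp, hL, hle⟩ := h
  refine ⟨ΩK, Ωp, L, hΩK, hΩp, hL, 0, fun G hG ↦ ?_⟩
  rw [pow_zero, map_one, one_mul]
  exact hle hG

end AnyPrime

/-! ## §2 `p = 3`: crux `TwinSplitIMCAtThreeGoodSSApZero` (23594) ⟺ its two halves -/

section ApZero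

/-- **Crux C₀ ⟹ its Howard half** (the registered stub `stub_howardFrameSS_apZero` of line
`threeframes-apzero`, verbatim): at every datum of the crux, some BDP frame lies in
`Ch_Λ(X_{∅,0})·R₀⟦T⟧`. [folklore] -/
theorem howardHalf_of_twinSplitIMCAtThreeGoodSSApZero (h : TwinSplitIMCAtThreeGoodSSApZero) :
    ∀ (W' : WeierstrassCurve ℚ) [W'.IsElliptic] [W'.IsGloballyMinimal] (N' : ℕ) [NeZero N']
      (K : Type) [Field K] [NumberField K] (Dt' : ModularParametrizationData W' N'),
      GoodSS W' 3 → W'.frobeniusTrace 3 = 0 → W'.HasSurjectiveModNGaloisRep 3 → W'.conductorNorm ℤ = N' →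
      IsImaginaryQuadratic K → SatisfiesHeegnerHypothesis N' K → Odd (NumberField.discr K) →
      ∀ (κ : ZpExtension K 3), κ.IsAnticyclotomic → ∀ (γ : absoluteGaloisGroup K) [Fact (κ.IsTopGenerator γ)]
        (𝔭 : HeightOneSpectrum (𝓞 K)), ((3 : ℕ) : 𝓞 K) ∈ 𝔭.asIdeal →
        𝔭.asIdeal.ramificationIdx (𝓞 ℚ) = 1 → 𝔭.asIdeal.inertiaDeg (𝓞 ℚ) = 1 →
        ∀ (𝔭' : HeightOneSpectrum (𝓞 K)), ((3 : ℕ) : 𝓞 K) ∈ 𝔭'.asIdeal → 𝔭' ≠ 𝔭 →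
        ∀ (ι' : PadicAlgCl 3 ≃+* ℂ), BranchInducesPrime 3 ι' 𝔭 →
        ∃ (ΩK : ℂ) (Ωp : ℂ_[3]) (L : UnrSeries 3), ΩK ≠ 0 ∧ Ωp ≠ 0 ∧
          IsBDPLFunction ι' 𝔭 κ γ Dt'.f ΩK Ωp L ∧
          L ∈ (AcSelmer.XAc.charIdeal (W'.baseChange K) 3 κ 𝔭' ∅ γ).map (PowerSeries.map (toUnr 3)) := by
  intro W' _ _ N' _ K _ _ Dt' hss ha hsurj hN' hK hH hodd κ hκ γ _ 𝔭 h𝔭 he hf 𝔭' h𝔭' hne ι' hι'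
  obtain ⟨hex, hall⟩ := h W' N' K Dt' hss ha hsurj hN' hK hH hodd κ hκ γ 𝔭 h𝔭 he hf 𝔭' h𝔭' hne ι' hι'
  exact exists_frame_mem_of_exists_of_forall_eq_span hex hall

/-- **Crux C₀ ⟹ its INTEGRAL Wan half**: at every datum of the crux, some BDP frame `L` has
`Ch_Λ(X_{∅,0})·R₀⟦T⟧ ⊆ (L)`. [folklore] -/
theorem integralWanHalf_of_twinSplitIMCAtThreeGoodSSApZero (h : TwinSplitIMCAtThreeGoodSSApZero) :
    ∀ (W' : WeierstrassCurve ℚ) [W'.IsElliptic] [W'.IsGloballyMinimal] (N' : ℕ) [NeZero N']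
      (K : Type) [Field K] [NumberField K] (Dt' : ModularParametrizationData W' N'),
      GoodSS W' 3 → W'.frobeniusTrace 3 = 0 → W'.HasSurjectiveModNGaloisRep 3 → W'.conductorNorm ℤ = N' →
      IsImaginaryQuadratic K → SatisfiesHeegnerHypothesis N' K → Odd (NumberField.discr K) →
      ∀ (κ : ZpExtension K 3), κ.IsAnticyclotomic → ∀ (γ : absoluteGaloisGroup K) [Fact (κ.IsTopGenerator γ)]
        (𝔭 : HeightOneSpectrum (𝓞 K)), ((3 : ℕ) : 𝓞 K) ∈ 𝔭.asIdeal →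
        𝔭.asIdeal.ramificationIdx (𝓞 ℚ) = 1 → 𝔭.asIdeal.inertiaDeg (𝓞 ℚ) = 1 →
        ∀ (𝔭' : HeightOneSpectrum (𝓞 K)), ((3 : ℕ) : 𝓞 K) ∈ 𝔭'.asIdeal → 𝔭' ≠ 𝔭 →
        ∀ (ι' : PadicAlgCl 3 ≃+* ℂ), BranchInducesPrime 3 ι' 𝔭 →
        ∃ (ΩK : ℂ) (Ωp : ℂ_[3]) (L : UnrSeries 3), ΩK ≠ 0 ∧ Ωp ≠ 0 ∧
          IsBDPLFunction ι' 𝔭 κ γ Dt'.f ΩK Ωp L ∧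
          (AcSelmer.XAc.charIdeal (W'.baseChange K) 3 κ 𝔭' ∅ γ).map (PowerSeries.map (toUnr 3)) ≤
            Ideal.span {L} := by
  intro W' _ _ N' _ K _ _ Dt' hss ha hsurj hN' hK hH hodd κ hκ γ _ 𝔭 h𝔭 he hf 𝔭' h𝔭' hne ι' hι'
  obtain ⟨hex, hall⟩ := h W' N' K Dt' hss ha hsurj hN' hK hH hodd κ hκ γ 𝔭 h𝔭 he hf 𝔭' h𝔭' hne ι' hι'
  exact exists_frame_le_span_of_exists_of_forall_eq_span hex hall

/-- **Crux C₀ ⟹ its rational Wan half** (the registered stub `stub_wanFrameSS_apZero` of line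
`threeframes-apzero`, verbatim; `k = 0` serves). [folklore] -/
theorem wanHalf_of_twinSplitIMCAtThreeGoodSSApZero (h : TwinSplitIMCAtThreeGoodSSApZero) :
    ∀ (W' : WeierstrassCurve ℚ) [W'.IsElliptic] [W'.IsGloballyMinimal] (N' : ℕ) [NeZero N']
      (K : Type) [Field K] [NumberField K] (Dt' : ModularParametrizationData W' N'),
      GoodSS W' 3 → W'.frobeniusTrace 3 = 0 → W'.HasSurjectiveModNGaloisRep 3 → W'.conductorNorm ℤ = N' →
      IsImaginaryQuadratic K → SatisfiesHeegnerHypothesis N' K → Odd (NumberField.discr K) →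
      ∀ (κ : ZpExtension K 3), κ.IsAnticyclotomic → ∀ (γ : absoluteGaloisGroup K) [Fact (κ.IsTopGenerator γ)]
        (𝔭 : HeightOneSpectrum (𝓞 K)), ((3 : ℕ) : 𝓞 K) ∈ 𝔭.asIdeal →
        𝔭.asIdeal.ramificationIdx (𝓞 ℚ) = 1 → 𝔭.asIdeal.inertiaDeg (𝓞 ℚ) = 1 →
        ∀ (𝔭' : HeightOneSpectrum (𝓞 K)), ((3 : ℕ) : 𝓞 K) ∈ 𝔭'.asIdeal → 𝔭' ≠ 𝔭 →
        ∀ (ι' : PadicAlgCl 3 ≃+* ℂ), BranchInducesPrime 3 ι' 𝔭 →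
        ∃ (ΩK : ℂ) (Ωp : ℂ_[3]) (L : UnrSeries 3), ΩK ≠ 0 ∧ Ωp ≠ 0 ∧
          IsBDPLFunction ι' 𝔭 κ γ Dt'.f ΩK Ωp L ∧
          ∃ k : ℕ, ∀ G ∈ (AcSelmer.XAc.charIdeal (W'.baseChange K) 3 κ 𝔭' ∅ γ).map
            (PowerSeries.map (toUnr 3)), PowerSeries.C (((3 : ℕ) : unrIntegers 3) ^ k) * G ∈ Ideal.span {L} := by
  intro W' _ _ N' _ K _ _ Dt' hss ha hsurj hN' hK hH hodd κ hκ γ _ 𝔭 h𝔭 he hf 𝔭' h𝔭' hne ι' hι'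
  obtain ⟨hex, hall⟩ := h W' N' K Dt' hss ha hsurj hN' hK hH hodd κ hκ γ 𝔭 h𝔭 he hf 𝔭' h𝔭' hne ι' hι'
  exact exists_frame_pow_mul_mem_span_of_exists_of_forall_eq_span hex hall

/-- **Howard half ∧ INTEGRAL Wan half ⟹ crux C₀**, UNCONDITIONALLY (no named fact): at each datum the two
frames generate the same ideal by integral cross-period rigidity (`twinSplit_instance_of_two_frames`,
p543791). [cite: Castella2018, Thm. 3.1 (arXiv:1704.06608 p. 9) (the frame predicate)] -/
theorem twinSplitIMCAtThreeGoodSSApZero_of_howardHalf_of_integralWanHalf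
    (hH : ∀ (W' : WeierstrassCurve ℚ) [W'.IsElliptic] [W'.IsGloballyMinimal] (N' : ℕ) [NeZero N']
      (K : Type) [Field K] [NumberField K] (Dt' : ModularParametrizationData W' N'),
      GoodSS W' 3 → W'.frobeniusTrace 3 = 0 → W'.HasSurjectiveModNGaloisRep 3 → W'.conductorNorm ℤ = N' →
      IsImaginaryQuadratic K → SatisfiesHeegnerHypothesis N' K → Odd (NumberField.discr K) →
      ∀ (κ : ZpExtension K 3), κ.IsAnticyclotomic → ∀ (γ : absoluteGaloisGroup K) [Fact (κ.IsTopGenerator γ)]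
        (𝔭 : HeightOneSpectrum (𝓞 K)), ((3 : ℕ) : 𝓞 K) ∈ 𝔭.asIdeal →
        𝔭.asIdeal.ramificationIdx (𝓞 ℚ) = 1 → 𝔭.asIdeal.inertiaDeg (𝓞 ℚ) = 1 →
        ∀ (𝔭' : HeightOneSpectrum (𝓞 K)), ((3 : ℕ) : 𝓞 K) ∈ 𝔭'.asIdeal → 𝔭' ≠ 𝔭 →
        ∀ (ι' : PadicAlgCl 3 ≃+* ℂ), BranchInducesPrime 3 ι' 𝔭 →
        ∃ (ΩK : ℂ) (Ωp : ℂ_[3]) (L : UnrSeries 3), ΩK ≠ 0 ∧ Ωp ≠ 0 ∧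
          IsBDPLFunction ι' 𝔭 κ γ Dt'.f ΩK Ωp L ∧
          L ∈ (AcSelmer.XAc.charIdeal (W'.baseChange K) 3 κ 𝔭' ∅ γ).map (PowerSeries.map (toUnr 3)))
    (hW : ∀ (W' : WeierstrassCurve ℚ) [W'.IsElliptic] [W'.IsGloballyMinimal] (N' : ℕ) [NeZero N']
      (K : Type) [Field K] [NumberField K] (Dt' : ModularParametrizationData W' N'),
      GoodSS W' 3 → W'.frobeniusTrace 3 = 0 → W'.HasSurjectiveModNGaloisRep 3 → W'.conductorNorm ℤ = N' →
      IsImaginaryQuadratic K → SatisfiesHeegnerHypothesis N' K → Odd (NumberField.discr K) →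
      ∀ (κ : ZpExtension K 3), κ.IsAnticyclotomic → ∀ (γ : absoluteGaloisGroup K) [Fact (κ.IsTopGenerator γ)]
        (𝔭 : HeightOneSpectrum (𝓞 K)), ((3 : ℕ) : 𝓞 K) ∈ 𝔭.asIdeal →
        𝔭.asIdeal.ramificationIdx (𝓞 ℚ) = 1 → 𝔭.asIdeal.inertiaDeg (𝓞 ℚ) = 1 →
        ∀ (𝔭' : HeightOneSpectrum (𝓞 K)), ((3 : ℕ) : 𝓞 K) ∈ 𝔭'.asIdeal → 𝔭' ≠ 𝔭 →
        ∀ (ι' : PadicAlgCl 3 ≃+* ℂ), BranchInducesPrime 3 ι' 𝔭 →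
        ∃ (ΩK : ℂ) (Ωp : ℂ_[3]) (L : UnrSeries 3), ΩK ≠ 0 ∧ Ωp ≠ 0 ∧
          IsBDPLFunction ι' 𝔭 κ γ Dt'.f ΩK Ωp L ∧
          (AcSelmer.XAc.charIdeal (W'.baseChange K) 3 κ 𝔭' ∅ γ).map (PowerSeries.map (toUnr 3)) ≤
            Ideal.span {L}) :
    TwinSplitIMCAtThreeGoodSSApZero := by
  intro W' _ _ N' _ K _ _ Dt' hss ha hsurj hN' hK hH' hodd κ hκ γ _ 𝔭 h𝔭 he hf 𝔭' h𝔭' hne ι' hι'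
  exact twinSplit_instance_of_two_frames W' N' K Dt' κ γ 𝔭 𝔭' ι' hK hκ
    (hH W' N' K Dt' hss ha hsurj hN' hK hH' hodd κ hκ γ 𝔭 h𝔭 he hf 𝔭' h𝔭' hne ι' hι')
    (hW W' N' K Dt' hss ha hsurj hN' hK hH' hodd κ hκ γ 𝔭 h𝔭 he hf 𝔭' h𝔭' hne ι' hι')

/-- **THE LOSSLESS SPLIT of crux C₀ (item 23594): `TwinSplitIMCAtThreeGoodSSApZero` ⟺ (Howard half at
every datum) ∧ (integral Wan half at every datum)**, unconditionally and by name. The `⊇` half is the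
port-shaped statement (Castella–Wan 2024 Thm. 5.12 + §6.1 at `p = 3`, `a_p = 0`); the `⊆` half is the
statement not in print at `p = 3` under the classical Heegner hypothesis.
[cite: Castella2018, Thm. 3.1 (arXiv:1704.06608 p. 9) (the frame predicate)] -/
theorem twinSplitIMCAtThreeGoodSSApZero_iff_halves :
    TwinSplitIMCAtThreeGoodSSApZero ↔
    ((∀ (W' : WeierstrassCurve ℚ) [W'.IsElliptic] [W'.IsGloballyMinimal] (N' : ℕ) [NeZero N']
      (K : Type) [Field K] [NumberField K] (Dt' : ModularParametrizationData W' N'),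
      GoodSS W' 3 → W'.frobeniusTrace 3 = 0 → W'.HasSurjectiveModNGaloisRep 3 → W'.conductorNorm ℤ = N' →
      IsImaginaryQuadratic K → SatisfiesHeegnerHypothesis N' K → Odd (NumberField.discr K) →
      ∀ (κ : ZpExtension K 3), κ.IsAnticyclotomic → ∀ (γ : absoluteGaloisGroup K) [Fact (κ.IsTopGenerator γ)]
        (𝔭 : HeightOneSpectrum (𝓞 K)), ((3 : ℕ) : 𝓞 K) ∈ 𝔭.asIdeal →
        𝔭.asIdeal.ramificationIdx (𝓞 ℚ) = 1 → 𝔭.asIdeal.inertiaDeg (𝓞 ℚ) = 1 →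
        ∀ (𝔭' : HeightOneSpectrum (𝓞 K)), ((3 : ℕ) : 𝓞 K) ∈ 𝔭'.asIdeal → 𝔭' ≠ 𝔭 →
        ∀ (ι' : PadicAlgCl 3 ≃+* ℂ), BranchInducesPrime 3 ι' 𝔭 →
        ∃ (ΩK : ℂ) (Ωp : ℂ_[3]) (L : UnrSeries 3), ΩK ≠ 0 ∧ Ωp ≠ 0 ∧
          IsBDPLFunction ι' 𝔭 κ γ Dt'.f ΩK Ωp L ∧
          L ∈ (AcSelmer.XAc.charIdeal (W'.baseChange K) 3 κ 𝔭' ∅ γ).map (PowerSeries.map (toUnr 3))) ∧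
    (∀ (W' : WeierstrassCurve ℚ) [W'.IsElliptic] [W'.IsGloballyMinimal] (N' : ℕ) [NeZero N']
      (K : Type) [Field K] [NumberField K] (Dt' : ModularParametrizationData W' N'),
      GoodSS W' 3 → W'.frobeniusTrace 3 = 0 → W'.HasSurjectiveModNGaloisRep 3 → W'.conductorNorm ℤ = N' →
      IsImaginaryQuadratic K → SatisfiesHeegnerHypothesis N' K → Odd (NumberField.discr K) →
      ∀ (κ : ZpExtension K 3), κ.IsAnticyclotomic → ∀ (γ : absoluteGaloisGroup K) [Fact (κ.IsTopGenerator γ)]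
        (𝔭 : HeightOneSpectrum (𝓞 K)), ((3 : ℕ) : 𝓞 K) ∈ 𝔭.asIdeal →
        𝔭.asIdeal.ramificationIdx (𝓞 ℚ) = 1 → 𝔭.asIdeal.inertiaDeg (𝓞 ℚ) = 1 →
        ∀ (𝔭' : HeightOneSpectrum (𝓞 K)), ((3 : ℕ) : 𝓞 K) ∈ 𝔭'.asIdeal → 𝔭' ≠ 𝔭 →
        ∀ (ι' : PadicAlgCl 3 ≃+* ℂ), BranchInducesPrime 3 ι' 𝔭 →
        ∃ (ΩK : ℂ) (Ωp : ℂ_[3]) (L : UnrSeries 3), ΩK ≠ 0 ∧ Ωp ≠ 0 ∧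
          IsBDPLFunction ι' 𝔭 κ γ Dt'.f ΩK Ωp L ∧
          (AcSelmer.XAc.charIdeal (W'.baseChange K) 3 κ 𝔭' ∅ γ).map (PowerSeries.map (toUnr 3)) ≤
            Ideal.span {L})) :=
  ⟨fun h ↦ ⟨howardHalf_of_twinSplitIMCAtThreeGoodSSApZero h,
    integralWanHalf_of_twinSplitIMCAtThreeGoodSSApZero h⟩,
    fun h ↦ twinSplitIMCAtThreeGoodSSApZero_of_howardHalf_of_integralWanHalf h.1 h.2⟩

/-- **Howard half ∧ the registered RATIONAL Wan half ⟹ crux C₀**, CONDITIONAL on the refereed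
`μ = 0`-frame fact BCS 2025 Prop. 4.2.2 (`h422`, good reduction at `p > 2`, no ordinarity; consumed through
`twinSplit_instance_of_howardFrame_of_wanFrame_of_good`, p543791): the line's two research stubs verbatim.
[cite: BurungaleCastellaSkinner2025, Prop. 4.2.2 (arXiv:2405.00270v2 §4.2, pp. 8–9)] -/
theorem twinSplitIMCAtThreeGoodSSApZero_of_howardHalf_of_wanHalf_of_prop422
    (h422 : BurungaleCastellaSkinner2025.prop422_exists_isBDPLFunction_mu_eq_zero)
    (hH : ∀ (W' : WeierstrassCurve ℚ) [W'.IsElliptic] [W'.IsGloballyMinimal] (N' : ℕ) [NeZero N']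
      (K : Type) [Field K] [NumberField K] (Dt' : ModularParametrizationData W' N'),
      GoodSS W' 3 → W'.frobeniusTrace 3 = 0 → W'.HasSurjectiveModNGaloisRep 3 → W'.conductorNorm ℤ = N' →
      IsImaginaryQuadratic K → SatisfiesHeegnerHypothesis N' K → Odd (NumberField.discr K) →
      ∀ (κ : ZpExtension K 3), κ.IsAnticyclotomic → ∀ (γ : absoluteGaloisGroup K) [Fact (κ.IsTopGenerator γ)]
        (𝔭 : HeightOneSpectrum (𝓞 K)), ((3 : ℕ) : 𝓞 K) ∈ 𝔭.asIdeal →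
        𝔭.asIdeal.ramificationIdx (𝓞 ℚ) = 1 → 𝔭.asIdeal.inertiaDeg (𝓞 ℚ) = 1 →
        ∀ (𝔭' : HeightOneSpectrum (𝓞 K)), ((3 : ℕ) : 𝓞 K) ∈ 𝔭'.asIdeal → 𝔭' ≠ 𝔭 →
        ∀ (ι' : PadicAlgCl 3 ≃+* ℂ), BranchInducesPrime 3 ι' 𝔭 →
        ∃ (ΩK : ℂ) (Ωp : ℂ_[3]) (L : UnrSeries 3), ΩK ≠ 0 ∧ Ωp ≠ 0 ∧
          IsBDPLFunction ι' 𝔭 κ γ Dt'.f ΩK Ωp L ∧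
          L ∈ (AcSelmer.XAc.charIdeal (W'.baseChange K) 3 κ 𝔭' ∅ γ).map (PowerSeries.map (toUnr 3)))
    (hW : ∀ (W' : WeierstrassCurve ℚ) [W'.IsElliptic] [W'.IsGloballyMinimal] (N' : ℕ) [NeZero N']
      (K : Type) [Field K] [NumberField K] (Dt' : ModularParametrizationData W' N'),
      GoodSS W' 3 → W'.frobeniusTrace 3 = 0 → W'.HasSurjectiveModNGaloisRep 3 → W'.conductorNorm ℤ = N' →
      IsImaginaryQuadratic K → SatisfiesHeegnerHypothesis N' K → Odd (NumberField.discr K) →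
      ∀ (κ : ZpExtension K 3), κ.IsAnticyclotomic → ∀ (γ : absoluteGaloisGroup K) [Fact (κ.IsTopGenerator γ)]
        (𝔭 : HeightOneSpectrum (𝓞 K)), ((3 : ℕ) : 𝓞 K) ∈ 𝔭.asIdeal →
        𝔭.asIdeal.ramificationIdx (𝓞 ℚ) = 1 → 𝔭.asIdeal.inertiaDeg (𝓞 ℚ) = 1 →
        ∀ (𝔭' : HeightOneSpectrum (𝓞 K)), ((3 : ℕ) : 𝓞 K) ∈ 𝔭'.asIdeal → 𝔭' ≠ 𝔭 →
        ∀ (ι' : PadicAlgCl 3 ≃+* ℂ), BranchInducesPrime 3 ι' 𝔭 →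
        ∃ (ΩK : ℂ) (Ωp : ℂ_[3]) (L : UnrSeries 3), ΩK ≠ 0 ∧ Ωp ≠ 0 ∧
          IsBDPLFunction ι' 𝔭 κ γ Dt'.f ΩK Ωp L ∧
          ∃ k : ℕ, ∀ G ∈ (AcSelmer.XAc.charIdeal (W'.baseChange K) 3 κ 𝔭' ∅ γ).map
            (PowerSeries.map (toUnr 3)), PowerSeries.C (((3 : ℕ) : unrIntegers 3) ^ k) * G ∈ Ideal.span {L}) :
    TwinSplitIMCAtThreeGoodSSApZero := by
  intro W' _ _ N' _ K _ _ Dt' hss ha hsurj hN' hK hH' hodd κ hκ γ _ 𝔭 h𝔭 he hf 𝔭' h𝔭' hne ι' hι'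
  exact twinSplit_instance_of_howardFrame_of_wanFrame_of_good W' N' K Dt' κ γ 𝔭 𝔭' ι' h422 hss.1 hsurj
    hK hH' hodd hκ h𝔭 he hf hι'
    (hH W' N' K Dt' hss ha hsurj hN' hK hH' hodd κ hκ γ 𝔭 h𝔭 he hf 𝔭' h𝔭' hne ι' hι')
    (hW W' N' K Dt' hss ha hsurj hN' hK hH' hodd κ hκ γ 𝔭 h𝔭 he hf 𝔭' h𝔭' hne ι' hι')

end ApZero

end Summit.BirchSwinnertonDyer.BirchSwinnertonDyer.Theorems.UniversalToricDescentTwinSplit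

end
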